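import Mathlib
import HarnessLib
import Literature.Analysis.FluidPDE.MeridianReduction
import Literature.Analysis.FluidPDE.SereginZajaczkowski2007L42VorticityProofs

/-!
# Crux `AxisTwistDoor.AveragedConeLiouville` (stmt-NavierStokesRegularity-26889), line `lrt_shell` (LEAD ns-atd-p1 g0): brick C6 —
# THE 3D LIFT: LAPLACIAN, GRADIENT AND RADIAL DRIFT OF A MERIDIAN PROFILE `x ↦ Γ(r(x), x₃)` OFF THE AXIS

Lei–Ren–Tian, arXiv:2501.08976, §4 pp. 11–12, run the positivity-propagation step for `V = sup Γ − Γ` regarded as a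
function on `ℝ³ × (t)` through `x ↦ Γ(|x_h|, x₃, t)`; the one-sided shell inequality (eq. Gamma-34) in the variables
`(r, z)` becomes a pointwise supersolution inequality `∂ₜV − ΔV + b·∇V ≥ 0` in `ℝ³` off the axis with the radial drift
`b = (c/r) e_r`.  The dictionary is folklore calculus in cylindrical coordinates, absent from the tree in this form:

* `fderiv_comp_meridian_dir` — `D(G ∘ meridian)(y) h = ⟪e_r(y), h⟫ ∂ᵣG + h₂ ∂_zG` off the axis;
* `laplacian_comp_meridian` — **`Δ(G ∘ meridian)(x) = ∂ᵣ²G + r⁻¹ ∂ᵣG + ∂_z²G`** at `(r, z) = (cylRadius x, x₂)`, `r ≠ 0`,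
  for `G : ℝ × ℝ → ℝ` of class `C²` near `(r, z)` (second partials as `fderiv (fun q => fderiv G q (1,0)) (r,z) (1,0)` etc.);
* `laplacian_cyl` — the same for a curried profile `Γ : ℝ → ℝ → ℝ`, with the nested one-variable derivatives
  `deriv (fun r' => deriv (fun r'' => Γ r'' z) r') r + r⁻¹ deriv (Γ · z) r + deriv (fun z' => deriv (Γ r ·) z') z` used by the
  line's Gamma-34 file;
* `fderiv_cyl_apply`, `inner_radialDrift_gradient_cyl` — `D(Γ(r,x₃))(x) h = ∂ᵣΓ ⟪e_r, h⟫ + ∂_zΓ h₂` and, for the drift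
  `(c/r²) x_h` of brick C4, `⟪(c/r²) x_h, ∇(Γ(r, x₃))⟫ = (c/r) ∂ᵣΓ`.

WHAT THIS IS NOT: not NS regularity, not the crux — a helper `--supports stmt-NavierStokesRegularity-26889 --as helper` (width seat
ns-cas-k2 g0); ACL 26889 and NS regularity are OPEN.  [cite: LeiRenTian2025, §4 pp. 11–12 (the lift of (Gamma-34) to ℝ³ for Lemma 2.5)]
-/

noncomputable section

set_option linter.dupNamespace false

namespace Summit.NavierStokesRegularity.NavierStokesRegularity.Theorems.AveragedConeLiouville.MeridianLaplacian

open scoped Topology InnerProductSpace Laplacian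
open Set Function Filter
open Literature.Analysis Literature.Analysis.FluidPDE
open Literature.Analysis.FluidPDE.SereginZajaczkowski2007

variable {G : ℝ × ℝ → ℝ} {x : EuclideanSpace ℝ (Fin 3)}

/-! ### Linear algebra on `ℝ × ℝ` and the first derivative through the meridian coordinates -/

/-- `L(a, b) = a L(1,0) + b L(0,1)` for a linear functional on `ℝ × ℝ` (private copy of the tree's
`Literature.Geometry.Riemannian.clm_prod_apply_eq`, whose module is a heavy unrelated import). [folklore] -/
private theorem clm_pair_apply (L : ℝ × ℝ →L[ℝ] ℝ) (a b : ℝ) : L (a, b) = a * L (1, 0) + b * L (0, 1) := by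
  have h : ((a, b) : ℝ × ℝ) = a • ((1, 0) : ℝ × ℝ) + b • ((0, 1) : ℝ × ℝ) := by ext <;> simp
  rw [h, map_add, map_smul, map_smul, smul_eq_mul, smul_eq_mul]

/-- Components of `e_r`: `e_r(y)₀ = y₀/r`, `e_r(y)₁ = y₁/r`. [folklore] -/
theorem eR_apply_zero_one (y : EuclideanSpace ℝ (Fin 3)) :
    eR y 0 = (cylRadius y)⁻¹ * y 0 ∧ eR y 1 = (cylRadius y)⁻¹ * y 1 := by
  simp [eR]

/-- **First derivative through the meridian coordinates, split into partials**: off the axis,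
`D(G ∘ meridian)(y) h = ⟪e_r(y), h⟫ ∂ᵣG(r,z) + h₂ ∂_zG(r,z)`. [folklore] -/
theorem fderiv_comp_meridian_dir {y : EuclideanSpace ℝ (Fin 3)} (hy : cylRadius y ≠ 0)
    (hG : DifferentiableAt ℝ G (meridian y)) (h : EuclideanSpace ℝ (Fin 3)) :
    fderiv ℝ (fun w => G (meridian w)) y h =
      ⟪eR y, h⟫_ℝ * fderiv ℝ G (meridian y) (1, 0) + h 2 * fderiv ℝ G (meridian y) (0, 1) := by
  rw [fderiv_comp_meridian_apply hy hG, clm_pair_apply]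

/-! ### The Laplacian in cylindrical coordinates for a meridian profile -/

/-- **`Δ(G ∘ meridian)(x) = ∂ᵣ²G + r⁻¹∂ᵣG + ∂_z²G`** at `(r,z) = meridian x = (cylRadius x, x₂)`, `x` off the axis, for `G` of
class `C²` near `(r, z)` (`|∇r|² = 1`, `∇r ⊥ ∇z`, `Δr = 1/r`, `Δz = 0`). [folklore] -/
theorem laplacian_comp_meridian (hx : cylRadius x ≠ 0) (hG : ContDiffAt ℝ 2 G (meridian x)) :
    (Δ fun y => G (meridian y)) x =
      fderiv ℝ (fun q => fderiv ℝ G q (1, 0)) (meridian x) (1, 0)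
        + (cylRadius x)⁻¹ * fderiv ℝ G (meridian x) (1, 0)
        + fderiv ℝ (fun q => fderiv ℝ G q (0, 1)) (meridian x) (0, 1) := by
  set f : EuclideanSpace ℝ (Fin 3) → ℝ := fun y => G (meridian y) with hf_def
  set b := EuclideanSpace.basisFun (Fin 3) ℝ with hb
  have hb' : ∀ i, b i = EuclideanSpace.single i 1 := fun i => by simp [hb]
  -- the partial-derivative functions of `G`
  set Gr : ℝ × ℝ → ℝ := fun q => fderiv ℝ G q (1, 0) with hGr_def
  set Gz : ℝ × ℝ → ℝ := fun q => fderiv ℝ G q (0, 1) with hGz_def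
  -- regularity
  have hmer : ContDiffAt ℝ 2 meridian x :=
    (contDiffAt_cylRadius hx).prodMk
      ((EuclideanSpace.proj (2 : Fin 3) : EuclideanSpace ℝ (Fin 3) →L[ℝ] ℝ).contDiff.contDiffAt)
  have hfx : ContDiffAt ℝ 2 f x := hG.comp x hmer
  have hD : DifferentiableAt ℝ (fderiv ℝ f) x :=
    (hfx.fderiv_right (m := 1) le_rfl).differentiableAt one_ne_zero
  have hGd : DifferentiableAt ℝ G (meridian x) := hG.differentiableAt two_ne_zero
  have hG1 : ContDiffAt ℝ 1 (fderiv ℝ G) (meridian x) := hG.fderiv_right (m := 1) le_rfl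
  have hGr : DifferentiableAt ℝ Gr (meridian x) :=
    (hG1.clm_apply contDiffAt_const).differentiableAt one_ne_zero
  have hGz : DifferentiableAt ℝ Gz (meridian x) :=
    (hG1.clm_apply contDiffAt_const).differentiableAt one_ne_zero
  -- neighbourhoods: off the axis, and `G` differentiable at `meridian y`
  have hU : ∀ᶠ y in 𝓝 x, cylRadius y ≠ 0 :=
    (isOpen_ne_fun continuous_cylRadius continuous_const).mem_nhds hx
  have hmc : ContinuousAt meridian x := hmer.continuousAt
  have hGev : ∀ᶠ y in 𝓝 x, DifferentiableAt ℝ G (meridian y) := by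
    have h2 : ∀ᶠ q in 𝓝 (meridian x), ContDiffAt ℝ 2 G q := hG.eventually (by simp)
    exact (hmc.eventually h2).mono fun y hy => hy.differentiableAt two_ne_zero
  -- the first partials near `x`
  have hdir0 : (fun y => fderiv ℝ f y (b 0)) =ᶠ[𝓝 x] fun y => (cylRadius y)⁻¹ * y 0 * Gr (meridian y) := by
    filter_upwards [hU, hGev] with y hy hGy
    rw [hb', fderiv_comp_meridian_dir hy hGy, EuclideanSpace.inner_single_right, (eR_apply_zero_one y).1]
    simp [hGr_def]
  have hdir1 : (fun y => fderiv ℝ f y (b 1)) =ᶠ[𝓝 x] fun y => (cylRadius y)⁻¹ * y 1 * Gr (meridian y) := by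
    filter_upwards [hU, hGev] with y hy hGy
    rw [hb', fderiv_comp_meridian_dir hy hGy, EuclideanSpace.inner_single_right, (eR_apply_zero_one y).2]
    simp [hGr_def]
  have hdir2 : (fun y => fderiv ℝ f y (b 2)) =ᶠ[𝓝 x] fun y => Gz (meridian y) := by
    filter_upwards [hU, hGev] with y hy hGy
    rw [hb', fderiv_comp_meridian_dir hy hGy, EuclideanSpace.inner_single_right, eR_apply_two]
    simp [hGz_def]
  -- abbreviations for the values at `x`
  have hr3 : cylRadius x ^ 3 ≠ 0 := pow_ne_zero 3 hx
  have hρ : x 0 ^ 2 + x 1 ^ 2 = cylRadius x ^ 2 := (cylRadius_sq x).symm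
  -- second partials at `x`
  have hproj : ∀ i : Fin 3, HasFDerivAt (fun y : EuclideanSpace ℝ (Fin 3) => y i)
      (EuclideanSpace.proj i : EuclideanSpace ℝ (Fin 3) →L[ℝ] ℝ) x := fun i =>
    (EuclideanSpace.proj i : EuclideanSpace ℝ (Fin 3) →L[ℝ] ℝ).hasFDerivAt
  have hGrm : HasFDerivAt (fun y => Gr (meridian y))
      ((fderiv ℝ Gr (meridian x)).comp
        ((innerSL ℝ (eR x)).prod (EuclideanSpace.proj (2 : Fin 3) : EuclideanSpace ℝ (Fin 3) →L[ℝ] ℝ))) x :=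
    hasFDerivAt_comp_meridian hx hGr
  have hGzm : HasFDerivAt (fun y => Gz (meridian y))
      ((fderiv ℝ Gz (meridian x)).comp
        ((innerSL ℝ (eR x)).prod (EuclideanSpace.proj (2 : Fin 3) : EuclideanSpace ℝ (Fin 3) →L[ℝ] ℝ))) x :=
    hasFDerivAt_comp_meridian hx hGz
  set Grr : ℝ := fderiv ℝ Gr (meridian x) (1, 0) with hGrr
  set Gzz : ℝ := fderiv ℝ Gz (meridian x) (0, 1) with hGzz
  have key1 : ∀ a : ℝ, fderiv ℝ Gr (cylRadius x, x 2) (a, 0) = a * Grr := fun a => by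
    show fderiv ℝ Gr (meridian x) (a, 0) = a * Grr
    rw [clm_pair_apply, hGrr]; ring
  have key2 : ∀ a : ℝ, fderiv ℝ Gz (cylRadius x, x 2) (0, a) = a * Gzz := fun a => by
    show fderiv ℝ Gz (meridian x) (0, a) = a * Gzz
    rw [clm_pair_apply, hGzz]; ring
  have hsec : ∀ i : Fin 3, i = 0 ∨ i = 1 →
      fderiv ℝ (fun y => (cylRadius y)⁻¹ * y i * Gr (meridian y)) x (EuclideanSpace.single i 1) =
        ((cylRadius x)⁻¹ - (cylRadius x ^ 3)⁻¹ * x i ^ 2) * Gr (meridian x)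
          + (cylRadius x)⁻¹ ^ 2 * x i ^ 2 * Grr := by
    intro i hi
    rw [(((hasFDerivAt_inv_cylRadius hx).fun_mul (hproj i)).fun_mul hGrm).fderiv]
    rcases hi with rfl | rfl <;>
      simp [ContinuousLinearMap.comp_apply, innerSL_apply_apply, inner_eR_left, key1] <;>
      field_simp <;> ring
  have hsec2 : fderiv ℝ (fun y => Gz (meridian y)) x (EuclideanSpace.single 2 1) = Gzz := by
    rw [hGzm.fderiv]
    simp [ContinuousLinearMap.comp_apply, innerSL_apply_apply, EuclideanSpace.inner_single_right, eR_apply_two, key2]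
  -- assemble
  rw [InnerProductSpace.laplacian_eq_iteratedFDeriv_orthonormalBasis f b]
  have h1 : ∀ i, iteratedFDeriv ℝ 2 f x ![b i, b i] = fderiv ℝ (fun y => fderiv ℝ f y (b i)) x (b i) := fun i => by
    rw [iteratedFDeriv_two_apply, fderiv_clm_apply hD (differentiableAt_const _)]
    simp
  simp only [Fin.sum_univ_three, h1]
  rw [hdir0.fderiv_eq, hdir1.fderiv_eq, hdir2.fderiv_eq, hb', hb', hb', hsec 0 (Or.inl rfl), hsec 1 (Or.inr rfl), hsec2]
  field_simp
  linear_combination (Grr * cylRadius x - Gr (meridian x)) * hρ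

/-! ### Curried profiles `Γ : ℝ → ℝ → ℝ`: one-variable derivatives -/

/-- The partial derivative in the first variable as a one-variable derivative. [folklore] -/
theorem deriv_fst_eq_fderiv {r z : ℝ} (hG : DifferentiableAt ℝ G (r, z)) :
    deriv (fun r' => G (r', z)) r = fderiv ℝ G (r, z) (1, 0) := by
  have h := hG.hasFDerivAt.comp_hasDerivAt r ((hasDerivAt_id r).prodMk (hasDerivAt_const r z))
  exact h.deriv

/-- The partial derivative in the second variable as a one-variable derivative. [folklore] -/
theorem deriv_snd_eq_fderiv {r z : ℝ} (hG : DifferentiableAt ℝ G (r, z)) :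
    deriv (fun z' => G (r, z')) z = fderiv ℝ G (r, z) (0, 1) := by
  have h := hG.hasFDerivAt.comp_hasDerivAt z ((hasDerivAt_const z r).prodMk (hasDerivAt_id z))
  exact h.deriv

/-- The pure second partial in the first variable as a nested one-variable derivative, for `G` of class `C²` near
`(r, z)`. [folklore] -/
theorem deriv_deriv_fst_eq {r z : ℝ} (hG : ContDiffAt ℝ 2 G (r, z)) :
    deriv (fun r' => deriv (fun r'' => G (r'', z)) r') r = fderiv ℝ (fun q => fderiv ℝ G q (1, 0)) (r, z) (1, 0) := by
  have hev : ∀ᶠ q in 𝓝 ((r, z) : ℝ × ℝ), ContDiffAt ℝ 2 G q := hG.eventually (by simp)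
  have hc : ContinuousAt (fun r' : ℝ => ((r', z) : ℝ × ℝ)) r := (continuous_id.prodMk continuous_const).continuousAt
  have he : (fun r' => deriv (fun r'' => G (r'', z)) r') =ᶠ[𝓝 r] fun r' => fderiv ℝ G (r', z) (1, 0) := by
    filter_upwards [hc.eventually hev] with r' hr'
    exact deriv_fst_eq_fderiv (hr'.differentiableAt two_ne_zero)
  rw [he.deriv_eq]
  have hGr : DifferentiableAt ℝ (fun q => fderiv ℝ G q (1, 0)) (r, z) :=
    ((hG.fderiv_right (m := 1) le_rfl).clm_apply contDiffAt_const).differentiableAt one_ne_zero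
  exact deriv_fst_eq_fderiv hGr

/-- The pure second partial in the second variable as a nested one-variable derivative. [folklore] -/
theorem deriv_deriv_snd_eq {r z : ℝ} (hG : ContDiffAt ℝ 2 G (r, z)) :
    deriv (fun z' => deriv (fun z'' => G (r, z'')) z') z = fderiv ℝ (fun q => fderiv ℝ G q (0, 1)) (r, z) (0, 1) := by
  have hev : ∀ᶠ q in 𝓝 ((r, z) : ℝ × ℝ), ContDiffAt ℝ 2 G q := hG.eventually (by simp)
  have hc : ContinuousAt (fun z' : ℝ => ((r, z') : ℝ × ℝ)) z := (continuous_const.prodMk continuous_id).continuousAt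
  have he : (fun z' => deriv (fun z'' => G (r, z'')) z') =ᶠ[𝓝 z] fun z' => fderiv ℝ G (r, z') (0, 1) := by
    filter_upwards [hc.eventually hev] with z' hz'
    exact deriv_snd_eq_fderiv (hz'.differentiableAt two_ne_zero)
  rw [he.deriv_eq]
  have hGz : DifferentiableAt ℝ (fun q => fderiv ℝ G q (0, 1)) (r, z) :=
    ((hG.fderiv_right (m := 1) le_rfl).clm_apply contDiffAt_const).differentiableAt one_ne_zero
  exact deriv_snd_eq_fderiv hGz

/-! ### The lift for a curried meridian profile `x ↦ Γ(r(x), x₃)` -/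

/-- **`Δ Γ(r(x), x₃) = ∂ᵣ²Γ + r⁻¹∂ᵣΓ + ∂_z²Γ` off the axis**, with nested one-variable derivatives (the form of the line's
Gamma-34 file), for `Γ` jointly `C²` near `(r(x), x₃)`. [folklore] -/
theorem laplacian_cyl {Γ : ℝ → ℝ → ℝ} (hx : cylRadius x ≠ 0)
    (hΓ : ContDiffAt ℝ 2 (Function.uncurry Γ) (cylRadius x, x 2)) :
    (Δ fun y : EuclideanSpace ℝ (Fin 3) => Γ (cylRadius y) (y 2)) x =
      deriv (fun r' => deriv (fun r'' => Γ r'' (x 2)) r') (cylRadius x)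
        + (cylRadius x)⁻¹ * deriv (fun r' => Γ r' (x 2)) (cylRadius x)
        + deriv (fun z' => deriv (fun z'' => Γ (cylRadius x) z'') z') (x 2) := by
  have h := laplacian_comp_meridian (G := Function.uncurry Γ) hx hΓ
  have e1 : deriv (fun r' => deriv (fun r'' => Γ r'' (x 2)) r') (cylRadius x) =
      fderiv ℝ (fun q => fderiv ℝ (Function.uncurry Γ) q (1, 0)) (cylRadius x, x 2) (1, 0) := deriv_deriv_fst_eq hΓ
  have e2 : deriv (fun z' => deriv (fun z'' => Γ (cylRadius x) z'') z') (x 2) =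
      fderiv ℝ (fun q => fderiv ℝ (Function.uncurry Γ) q (0, 1)) (cylRadius x, x 2) (0, 1) := deriv_deriv_snd_eq hΓ
  have e3 : deriv (fun r' => Γ r' (x 2)) (cylRadius x) = fderiv ℝ (Function.uncurry Γ) (cylRadius x, x 2) (1, 0) :=
    deriv_fst_eq_fderiv (hΓ.differentiableAt two_ne_zero)
  rw [e1, e2, e3]
  exact h

/-- **The gradient of `Γ(r(x), x₃)` off the axis**: `D(Γ(r, x₃))(x) h = ∂ᵣΓ ⟪e_r(x), h⟫ + ∂_zΓ h₂`. [folklore] -/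
theorem fderiv_cyl_apply {Γ : ℝ → ℝ → ℝ} (hx : cylRadius x ≠ 0)
    (hΓ : DifferentiableAt ℝ (Function.uncurry Γ) (cylRadius x, x 2)) (h : EuclideanSpace ℝ (Fin 3)) :
    fderiv ℝ (fun y : EuclideanSpace ℝ (Fin 3) => Γ (cylRadius y) (y 2)) x h =
      deriv (fun r' => Γ r' (x 2)) (cylRadius x) * ⟪eR x, h⟫_ℝ + deriv (fun z' => Γ (cylRadius x) z') (x 2) * h 2 := by
  have h1 := fderiv_comp_meridian_dir (G := Function.uncurry Γ) hx hΓ h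
  have e1 : deriv (fun r' => Γ r' (x 2)) (cylRadius x) = fderiv ℝ (Function.uncurry Γ) (cylRadius x, x 2) (1, 0) :=
    deriv_fst_eq_fderiv hΓ
  have e2 : deriv (fun z' => Γ (cylRadius x) z') (x 2) = fderiv ℝ (Function.uncurry Γ) (cylRadius x, x 2) (0, 1) :=
    deriv_snd_eq_fderiv hΓ
  rw [e1, e2]
  calc fderiv ℝ (fun y : EuclideanSpace ℝ (Fin 3) => Γ (cylRadius y) (y 2)) x h
      = fderiv ℝ (fun w => Function.uncurry Γ (meridian w)) x h := rfl
    _ = _ := h1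
    _ = _ := by simp only [meridian_apply]; ring

/-- **The radial drift against the gradient**: for the drift `(c/r²) x_h` of brick C4 and `x` off the axis,
`⟪(c/r²) x_h, ∇(Γ(r, x₃))(x)⟫ = (c/r) ∂ᵣΓ`. [folklore] -/
theorem inner_radialDrift_gradient_cyl {Γ : ℝ → ℝ → ℝ} (hx : cylRadius x ≠ 0)
    (hΓ : DifferentiableAt ℝ (Function.uncurry Γ) (cylRadius x, x 2)) (c : ℝ) :
    ⟪(c / cylRadius x ^ 2) • (x 0 • EuclideanSpace.single (0 : Fin 3) (1 : ℝ) + x 1 • EuclideanSpace.single (1 : Fin 3) (1 : ℝ)),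
        gradient (fun y : EuclideanSpace ℝ (Fin 3) => Γ (cylRadius y) (y 2)) x⟫_ℝ =
      c / cylRadius x * deriv (fun r' => Γ r' (x 2)) (cylRadius x) := by
  rw [gradient, real_inner_comm, InnerProductSpace.toDual_symm_apply, fderiv_cyl_apply hx hΓ, inner_eR_left]
  have hρ : x 0 * x 0 + x 1 * x 1 = cylRadius x ^ 2 := by rw [cylRadius_sq]; ring
  simp
  field_simp
  linear_combination c * deriv (fun r' => Γ r' (x 2)) (cylRadius x) * hρ

end Summit.NavierStokesRegularity.NavierStokesRegularity.Theorems.AveragedConeLiouville.MeridianLaplacian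

end
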